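import Mathlib
import Summits.ResolutionOfSingularities.ResolutionOfSingularities.Theorems.WeightedInvariantLocalWeightedDropWildMonicFlagCauchy
import Summits.ResolutionOfSingularities.ResolutionOfSingularities.Theorems.WeightedInvariantLocalWeightedDropWildMonicShiftOrderCases
import Summits.ResolutionOfSingularities.ResolutionOfSingularities.Theorems.WeightedInvariantLocalWeightedDropWildMonicWCleanProcess

/-!
# `WeightedInvariant.LocalWeightedDrop`, line `hasse-ridge-face-selection`, S3ρ sub-stub S3ρD `stub_wildMonicSurfaceDescent`: item D-0
# «maximising flag» — COMPLETENESS OF A SETTING CLASS OF RE-CENTRINGS (the limit re-centring stays in the class)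

Crux item stmt-ResolutionOfSingularities-8899 `LocalWeightedDrop` (route `ResolutionOfSingularities/WeightedInvariant`), engine of the door
`HypersurfaceCentreConstruction` stmt-ResolutionOfSingularities-19897.  [OURS · L1 W4.3, chain w43, res-L1-w43-stub-3 (gen 3) on roadmap item
D-0 of `L/res-L1-w43-stub-7/S3RHOD-ROADMAP.md` (owners res-type-083 / stub-7); spec `L/res-L1-w43-stub-3/D0-SPEC.md` §8 (D-0d (α2)).  MODEL:
Perlega, arXiv:2011.14443 Ch. 5 §3, proof of Prop. 5.3.5 (p0067 L1–L10): «the power series `g_∞ = Σ G_i` … is well-defined.  By Lemma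
(m_under_coord_changes) … it follows that `(g_∞, h_∞) ∈ 𝒢`» — THE LIMIT OF A CHAIN OF SETTING-PRESERVING RE-CENTRINGS PRESERVES THE
SETTING.  Here a «setting» is a family `W` of weights with prescribed values `m w` of res-type-083's `WildMonic.wMin w (shift d B ·)`
that no re-centring dominates strictly (`hmax`); the chain is Cauchy for the level lines of `…WildMonicFlagAttainRecentre` (weights
`![δ₀!, M']`, thresholds `M'·δ₀ + w_{M'}(r₀)`).  Tools: res-type-083's `wMin_le_wMin_shift` / stub-7's `wMin_shift_eq_of_gt` (Per17 Lemma
5.1.6 (1)/(3): a re-centring on or above `m_w/d!` does not lower `wMin w`; one strictly below sets it), and the coefficientwise limit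
`exists_forall_coeff_sub_eq_zero_of_chain'₀` of `…WildMonicFlagCauchy`.  Definition-free.]

* `coeff_eq_zero_of_weight_lt_of_le` / `le_mul_weightedOrder_of_coeff` — «`c ≤ d!·ord_w f`» ⟺ «`f` has no monomial `e` with `d!·w(e) < c`»;
* `le_mul_weightedOrder_sub_of_wMin_eq` — two re-centrings with the same `wMin w` differ by a series on or above `m_w/d!` for `w`;
* **`exists_limit_mem_wMinClass`** — COMPLETENESS: a chain in the class, Cauchy for the level lines, has a limit in the class, on or above
  the level lines of every member (the `hcomplete` input of `exists_isGreatest_sFlag_shift_of_complete`, up to the dictionary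
  `(dRes, excExp) ↔ (wMin (1,0), wMin (0,1), wMin (1,1))`).
-/

set_option linter.dupNamespace false -- mandated namespace of this single-conjunct summit

namespace Summit.ResolutionOfSingularities.ResolutionOfSingularities.Theorems

namespace WildMonic

open MvPowerSeries

variable {k : Type} [Field k] {d : ℕ}

/-! ### `c ≤ d!·ord_w f` as a support condition -/

/-- If `c ≤ d!·ord_w(f)` then `f` has no monomial `e` with `d!·w(e) < c`. -/
theorem coeff_eq_zero_of_weight_lt_of_le {w : Fin 2 → ℕ} {f : MvPowerSeries (Fin 2) k} {c : ℕ∞} {e : Fin 2 →₀ ℕ}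
    (h : c ≤ (d.factorial : ℕ∞) * f.weightedOrder w) (he : ((d.factorial * Finsupp.weight w e : ℕ) : ℕ∞) < c) :
    coeff e f = 0 := by
  refine coeff_eq_zero_of_lt_weightedOrder w ?_
  by_contra hle
  rw [not_lt] at hle
  have h1 : (d.factorial : ℕ∞) * f.weightedOrder w ≤ ((d.factorial * Finsupp.weight w e : ℕ) : ℕ∞) := by
    push_cast
    gcongr
  exact absurd (lt_of_le_of_lt (h.trans h1) he) (lt_irrefl _)

/-- Conversely, if `f` has no monomial `e` with `d!·w(e) < c` then `c ≤ d!·ord_w(f)`. -/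
theorem le_mul_weightedOrder_of_coeff {w : Fin 2 → ℕ} {f : MvPowerSeries (Fin 2) k} {c : ℕ∞}
    (h : ∀ e : Fin 2 →₀ ℕ, ((d.factorial * Finsupp.weight w e : ℕ) : ℕ∞) < c → coeff e f = 0) :
    c ≤ (d.factorial : ℕ∞) * f.weightedOrder w := by
  by_cases hf : f = 0
  · rw [hf, weightedOrder_zero, ENat.mul_top (by exact_mod_cast (Nat.factorial_pos d).ne')]
    exact le_top
  obtain ⟨e, he, hwe⟩ := exists_coeff_ne_zero_and_weightedOrder w ((ne_zero_iff_weightedOrder_finite w).mp hf)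
  rw [← hwe]
  by_contra hlt
  rw [not_le] at hlt
  exact he (h e (by push_cast; exact hlt))

/-! ### Differences inside a setting class -/

/-- **PER17 LEMMA 5.1.6 (3), CONTRAPOSED**: two re-centrings `a`, `b` of `B` with the same `wMin w = m` differ by a series with
`m ≤ d!·ord_w(b − a)` — otherwise re-centring `shift d B a` by `b − a` (which gives `shift d B b`) would set `wMin w` to
`d!·ord_w(b − a) < m` (stub-7's `wMin_shift_eq_of_gt`). [cite: Perlega2020, Lemma 5.1.6 (arXiv:2011.14443 Ch. 5 §1)] -/
theorem le_mul_weightedOrder_sub_of_wMin_eq (hd : 0 < d) (w : Fin 2 → ℕ) (B : Fin d → MvPowerSeries (Fin 2) k)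
    (a b : MvPowerSeries (Fin 2) k) {m : ℕ∞} (ha : wMin w (shift d B a) = m) (hb : wMin w (shift d B b) = m) :
    m ≤ (d.factorial : ℕ∞) * (b - a).weightedOrder w := by
  by_contra hlt
  rw [not_le, ← ha] at hlt
  have h1 := wMin_shift_eq_of_gt w (shift d B a) (b - a) hd hlt
  rw [shift_shift, sub_add_cancel, hb, ← ha] at h1
  exact absurd (h1 ▸ hlt) (lt_irrefl _)

/-! ### Completeness of the class -/

/-- **THE LIMIT RE-CENTRING STAYS IN THE CLASS** (Per17 Prop. 5.3.5 proof, «`(g_∞, h_∞) ∈ 𝒢`», re-centrings only).  Data: base tuple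
`B` (`0 < d`), a family of weights `W` with class values `m w` — the class is
`{g : g(0) = 0, ∀ w ∈ W, wMin w (shift d B g) = m w}` — such that some `m w` is positive (`hpos`) and NO re-centring dominates the class
values strictly (`hmax`: `m w ≤ wMin w (shift d B g)` for all `w ∈ W` forces equality); level lines with weights `![δ₀!, M']` and
thresholds `M'·δ₀ + w_{M'}(r₀)`.  Then every chain `c` in the class with strictly increasing levels `N`, whose steps `c (j+1) − c j` lie
on or above every `M'`-line (`M' ≤ N j`), has a LIMIT `b` IN THE CLASS with `b − c j` on or above every `M'`-line, `M' ≤ N j`.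
Proof: the steps also lie on or above `m_w/d!` for `w ∈ W` (`le_mul_weightedOrder_sub_of_wMin_eq`); the coefficientwise limit
(`exists_forall_coeff_sub_eq_zero_of_chain'₀`, negligible := strictly below some of these finitely many + level lines) inherits all of
them; `wMin_le_wMin_shift` gives `m w ≤ wMin w (shift d B b)`, and `hmax` equality.
[cite: Perlega2020, Prop. 5.3.5 proof (arXiv:2011.14443 Ch. 5 §3, p0066 L75 – p0067 L10)] -/
theorem exists_limit_mem_wMinClass (hd : 0 < d) (B : Fin d → MvPowerSeries (Fin 2) k) (W : Set (Fin 2 → ℕ))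
    (m : (Fin 2 → ℕ) → ℕ∞) (δ₀ : ℕ) (r₀ : Fin 2 →₀ ℕ)
    (hpos : ∃ w ∈ W, 0 < m w)
    (hmax : ∀ g : MvPowerSeries (Fin 2) k, constantCoeff g = 0 → (∀ w ∈ W, m w ≤ wMin w (shift d B g)) →
      ∀ w ∈ W, wMin w (shift d B g) ≤ m w)
    (c : ℕ → MvPowerSeries (Fin 2) k) (N : ℕ → ℕ) (hN : StrictMono N)
    (hc : ∀ j, constantCoeff (c j) = 0 ∧ ∀ w ∈ W, wMin w (shift d B (c j)) = m w)
    (hlines : ∀ j M', M' ≤ N j → ((M' * δ₀ + Finsupp.weight ![δ₀.factorial, M'] r₀ : ℕ) : ℕ∞) ≤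
      (d.factorial : ℕ∞) * (c (j + 1) - c j).weightedOrder ![δ₀.factorial, M']) :
    ∃ b : MvPowerSeries (Fin 2) k, constantCoeff b = 0 ∧ (∀ w ∈ W, wMin w (shift d B b) = m w) ∧
      ∀ j M', M' ≤ N j → ((M' * δ₀ + Finsupp.weight ![δ₀.factorial, M'] r₀ : ℕ) : ℕ∞) ≤
        (d.factorial : ℕ∞) * (b - c j).weightedOrder ![δ₀.factorial, M'] := by
  -- negligible monomials at level `M`: strictly below `m_w/d!` for some `w ∈ W`, or strictly below some `M'`-line, `M' ≤ M`
  let Below : ℕ → (Fin 2 →₀ ℕ) → Prop := fun M e =>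
    (∃ w ∈ W, ((d.factorial * Finsupp.weight w e : ℕ) : ℕ∞) < m w) ∨
      ∃ M', M' ≤ M ∧ d.factorial * Finsupp.weight ![δ₀.factorial, M'] e < M' * δ₀ + Finsupp.weight ![δ₀.factorial, M'] r₀
  have hmono : ∀ {M M' : ℕ} {e : Fin 2 →₀ ℕ}, M ≤ M' → Below M e → Below M' e := by
    intro M M' e hMM' h
    rcases h with h | ⟨M'', hM'', h⟩
    · exact Or.inl h
    · exact Or.inr ⟨M'', hM''.trans hMM', h⟩
  -- the steps vanish on the negligible monomials
  have hsteps_w : ∀ j, ∀ w ∈ W, m w ≤ (d.factorial : ℕ∞) * (c (j + 1) - c j).weightedOrder w := fun j w hw =>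
    le_mul_weightedOrder_sub_of_wMin_eq hd w B (c j) (c (j + 1)) ((hc j).2 w hw) ((hc (j + 1)).2 w hw)
  have hstep : ∀ j (e : Fin 2 →₀ ℕ), Below (N j) e → coeff e (c (j + 1) - c j) = 0 := by
    intro j e he
    rcases he with ⟨w, hw, hlt⟩ | ⟨M', hM', hlt⟩
    · exact coeff_eq_zero_of_weight_lt_of_le (hsteps_w j w hw) hlt
    · exact coeff_eq_zero_of_weight_lt_of_le (hlines j M' hM') (by exact_mod_cast hlt)
  have h0 : ∃ j, Below (N j) 0 := by
    obtain ⟨w, hw, hmw⟩ := hpos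
    exact ⟨0, Or.inl ⟨w, hw, by simpa using hmw⟩⟩
  obtain ⟨b, hb0, -, hb⟩ := exists_forall_coeff_sub_eq_zero_of_chain'₀ Below hmono c N hN.monotone
    (fun M => ⟨M, hN.le_apply⟩) hstep (fun j => (hc j).1) h0
  -- the limit lies on or above everything the steps did
  have hb_w : ∀ j, ∀ w ∈ W, m w ≤ (d.factorial : ℕ∞) * (b - c j).weightedOrder w := fun j w hw =>
    le_mul_weightedOrder_of_coeff fun e he => hb j e (Or.inl ⟨w, hw, he⟩)
  have hb_lines : ∀ j M', M' ≤ N j → ((M' * δ₀ + Finsupp.weight ![δ₀.factorial, M'] r₀ : ℕ) : ℕ∞) ≤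
      (d.factorial : ℕ∞) * (b - c j).weightedOrder ![δ₀.factorial, M'] := fun j M' hM' =>
    le_mul_weightedOrder_of_coeff fun e he => hb j e (Or.inr ⟨M', hM', by exact_mod_cast he⟩)
  -- hence it is in the class
  have hge : ∀ w ∈ W, m w ≤ wMin w (shift d B b) := by
    intro w hw
    have h1 := wMin_le_wMin_shift w (shift d B (c 0)) (b - c 0) (by rw [(hc 0).2 w hw]; exact hb_w 0 w hw)
    rw [(hc 0).2 w hw, shift_shift, sub_add_cancel] at h1
    exact h1
  exact ⟨b, hb0, fun w hw => le_antisymm (hmax b hb0 hge w hw) (hge w hw), hb_lines⟩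

end WildMonic

end Summit.ResolutionOfSingularities.ResolutionOfSingularities.Theorems
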